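import Literature.Analysis.FluidPDE.NSVorticityEnergy
import Literature.Analysis.FluidPDE.SelfSimilar
import HarnessLib

/-!
# The head pressure of a Leray profile, in coordinates (Tsai 1998, (1.7)) — I: calculus

Analysis/FluidPDE support file for the decomposition of the named fact
`Literature.Analysis.FluidPDE.tsai_selfsimilar` (`FluidPDE/SelfSimilarLiouville`; Tsai, *On Leray's
self-similar solutions of the Navier–Stokes equations satisfying local energy estimates*, ARMA 143
(1998), Theorem 1). The main idea of Tsai's proof (following Nečas–Růžička–Šverák 1996) is that
for a smooth solution `(U, P)` of Leray's profile system
`−νΔU + aU + a(y·∇)U + (U·∇)U + ∇P = 0`, `div U = 0` (the tree's `IsLerayProfile ν a U P`), the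
**head pressure** (total pressure in self-similar variables)

  `Π(y) = ½|U(y)|² + P(y) + a y·U(y)`

satisfies `−νΔΠ + (U + a y)·∇Π = −ν|curl U|² ≤ 0` (Tsai 1998, (1.7)), so that the maximum
principle applies to `Π`. This file and its sequel `TsaiHeadPressureIdentity` prove (1.7) for
smooth profiles on `ℝ^ι = EuclideanSpace ℝ ι` (any finite index type `ι`; Tsai: `ℝ³`), in the
coordinate calculus of `CoordDerivatives` / `NSVorticityEnergy` (`pderiv l f = ∂ₗ f`).

## Contents (this file)

* `headPressure a U P`: the function `Π` (on any real inner product space);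
* coordinate bookkeeping: `pderiv_euclideanCoord` (`∂ₗ yᵢ = δᵢₗ`), `headPressure_eq_sum`,
  `laplacian_eq_sum_pderiv_pderiv'` (the scalar Laplacian `Δφ = ∑ₗ ∂ₗ∂ₗφ` on `ℝ^ι`; the tree's
  `laplacian_eq_sum_pderiv_pderiv` in `NSStrongSpeedBound` is the case `ι = Fin 3`, behind a heavy
  import);
* `pderiv_headPressure`, `pderiv_pderiv_headPressure`: for smooth `U`, `P`,
  `∂ₗΠ = ∑ᵢ (Uᵢ + a yᵢ) ∂ₗUᵢ + ∂ₗP + a Uₗ` and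
  `∂ₗ∂ₗΠ = ∑ᵢ (∂ₗUᵢ)² + ∑ᵢ (Uᵢ + a yᵢ) ∂ₗ∂ₗUᵢ + ∂ₗ∂ₗP + 2a ∂ₗUₗ`;
* the profile system in coordinates (`IsLerayProfile.profile_comp`,
  `IsLerayProfile.sum_pderiv_comp_eq_zero`), the pressure gradient solved from it
  (`IsLerayProfile.pderiv_pressure_eq`: `∂ᵢP = ν ∑ⱼ∂ⱼ∂ⱼUᵢ − aUᵢ − ∑ⱼ (Uⱼ + a yⱼ) ∂ⱼUᵢ`), whence
  **the pressure of a smooth-velocity profile is smooth**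
  (`IsLerayProfile.contDiff_pressure_of_smooth`; Tsai 1998, p. 34: "Since `U` is smooth, `P` is
  also smooth");
* derivatives of the incompressibility constraint (`∑ₗ ∂ₗ∂ⱼUₗ = 0`, `∑ₗ ∂ₗ∂ₖ∂ₖUₗ = 0`) and the
  **pressure Poisson equation** in trace form, `∑ₗ ∂ₗ∂ₗP = −∑ₗⱼ ∂ₗUⱼ ∂ⱼUₗ = −tr((∇U)²)`
  (`IsLerayProfile.sum_pderiv_pderiv_pressure`; Tsai 1998, (2.1): `−ΔP = ∑ ∂ᵢ∂ⱼ(UᵢUⱼ)`, which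
  for `div U = 0` equals `∑ ∂ᵢUⱼ ∂ⱼUᵢ`; the drift terms `aU + a(y·∇)U` are divergence free).

## Regularity

`IsLerayProfile` asks `U ∈ C²`, `P ∈ C¹`; the identity (1.7) needs one more derivative of each.
As in print ("every weak solution `U` of (1.3) is actually smooth", Tsai 1998, p. 33, by elliptic
regularity — to be vendored separately as a named fact) the computations here assume `U ∈ C^∞`
(`ContDiff ℝ ∞ U`); smoothness of `P` is then *proved* from the profile equation (`∂ᵢP` is a
smooth function, so `DP = ∑ᵢ ∂ᵢP • eᵢ*` is smooth, and `contDiff_infty_iff_fderiv`).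

## References

* T.-P. Tsai, *On Leray's self-similar solutions of the Navier–Stokes equations satisfying local
  energy estimates*, Arch. Rational Mech. Anal. 143 (1998) 29–51, (1.3), (1.7), (2.1), pp. 33–34
  [Tsai1998].
* J. Nečas, M. Růžička, V. Šverák, *On Leray's self-similar solutions of the Navier–Stokes
  equations*, Acta Math. 176 (1996) 283–294, §2 (the function `Π` and its equation)
  [NecasRuzickaSverak1996].
-/

noncomputable section

open MeasureTheory Set Function Filter Topology InnerProductSpace
open scoped ENNReal NNReal ContDiff BigOperators Laplacian RealInnerProductSpace

namespace Literature.Analysis.FluidPDE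

section HeadPressureDef

variable {E : Type*} [NormedAddCommGroup E] [InnerProductSpace ℝ E]

/-- The **head pressure** (Bernoulli / total pressure in self-similar variables) of a profile
pair `(U, P)` with rate `a`: `Π(y) = ½|U(y)|² + P(y) + a ⟪y, U(y)⟫` (Tsai 1998, display before
(1.7); Nečas–Růžička–Šverák 1996, §2). For a smooth Leray profile it satisfies
`−νΔΠ + (U + a y)·∇Π = −ν|curl U|² ≤ 0` (Tsai 1998, (1.7); `TsaiHeadPressureIdentity`). [cite: Tsai1998, (1.7)] -/
def headPressure (a : ℝ) (U : E → E) (P : E → ℝ) (y : E) : ℝ :=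
  2⁻¹ * ‖U y‖ ^ 2 + P y + a * ⟪y, U y⟫

/-- Unfolding the head pressure `Π(y) = ½|U(y)|² + P(y) + a ⟪y, U(y)⟫` (Tsai 1998, before (1.7)). [cite: Tsai1998, (1.7)] -/
theorem headPressure_apply (a : ℝ) (U : E → E) (P : E → ℝ) (y : E) :
    headPressure a U P y = 2⁻¹ * ‖U y‖ ^ 2 + P y + a * ⟪y, U y⟫ := rfl

end HeadPressureDef

section Coord

variable {ι : Type*} [Fintype ι] [DecidableEq ι]

local notation "𝔼" => EuclideanSpace ℝ ι

omit [DecidableEq ι] in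
/-- The coordinate functions `y ↦ yᵢ` of `ℝ^ι` are smooth (they are continuous linear). [folklore] -/
theorem contDiff_euclideanCoord (i : ι) {n : WithTop ℕ∞} : ContDiff ℝ n (fun y : 𝔼 => y i) :=
  (EuclideanSpace.proj i : 𝔼 →L[ℝ] ℝ).contDiff

omit [Fintype ι] [DecidableEq ι] in
/-- The coordinate functions `y ↦ yᵢ` of `ℝ^ι` are differentiable. [folklore] -/
theorem differentiable_euclideanCoord (i : ι) : Differentiable ℝ (fun y : 𝔼 => y i) :=
  (EuclideanSpace.proj i : 𝔼 →L[ℝ] ℝ).differentiable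

/-- `∂ₗ yᵢ = δᵢₗ`: partial derivatives of the coordinate functions. [folklore] -/
theorem pderiv_euclideanCoord (i l : ι) : pderiv l (fun y : 𝔼 => y i) = fun _ => if i = l then 1 else 0 := by
  funext y
  rw [pderiv_apply]
  have : (fun y : 𝔼 => y i) = (EuclideanSpace.proj i : 𝔼 →L[ℝ] ℝ) := rfl
  rw [this, ContinuousLinearMap.fderiv]
  simp

omit [DecidableEq ι] in
/-- Components of a `Cⁿ` map into `ℝ^ι` are `Cⁿ` (Mathlib `contDiff_euclidean`; the tree's
`contDiff_comp_of_contDiff` is the case `n = ∞`). [folklore] -/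
theorem contDiff_comp_euclidean {n : WithTop ℕ∞} {U : 𝔼 → 𝔼} (hU : ContDiff ℝ n U) (i : ι) :
    ContDiff ℝ n (fun y => U y i) :=
  contDiff_euclidean.1 hU i

omit [DecidableEq ι] in
/-- The inner product of `ℝ^ι` in coordinates, `⟪x, z⟫ = ∑ᵢ xᵢ zᵢ` (also in
`CoarseGrainingEstimates`, restated to keep the import light). [folklore] -/
theorem euclidean_inner_eq_sum_mul (x z : 𝔼) : ⟪x, z⟫ = ∑ i, x i * z i := by
  rw [PiLp.inner_apply]
  exact Finset.sum_congr rfl fun i _ => by rw [Real.inner_apply]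

omit [DecidableEq ι] in
/-- The head pressure in coordinates: `Π(y) = ½ ∑ᵢ Uᵢ(y)² + P(y) + a ∑ᵢ yᵢ Uᵢ(y)` (Tsai 1998,
before (1.7)). [cite: Tsai1998, (1.7)] -/
theorem headPressure_eq_sum (a : ℝ) (U : 𝔼 → 𝔼) (P : 𝔼 → ℝ) :
    headPressure a U P = fun y => 2⁻¹ * ∑ i, (U y i) ^ 2 + P y + a * ∑ i, y i * U y i := by
  funext y
  rw [headPressure_apply, EuclideanSpace.real_norm_sq_eq, euclidean_inner_eq_sum_mul]

/-- The scalar Laplacian in coordinates on `ℝ^ι`: `Δφ = ∑ⱼ ∂ⱼ∂ⱼφ` for `C²` functions (the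
tree's `laplacian_eq_sum_pderiv_pderiv` is the case `ι = Fin 3`). [folklore] -/
theorem laplacian_eq_sum_pderiv_pderiv' {φ : 𝔼 → ℝ} (hφ : ContDiff ℝ 2 φ) (x : 𝔼) :
    (Δ φ) x = ∑ j, pderiv j (pderiv j φ) x := by
  rw [laplacian_eq_sum_fderiv_fderiv (EuclideanSpace.basisFun ι ℝ) hφ x]
  refine Finset.sum_congr rfl fun j _ => ?_
  have hb : (EuclideanSpace.basisFun ι ℝ) j = (stdVec j : 𝔼) := by
    simp [stdVec, EuclideanSpace.basisFun_apply]
  rw [hb]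
  rfl

variable {ν a : ℝ} {U : EuclideanSpace ℝ ι → EuclideanSpace ℝ ι} {P : EuclideanSpace ℝ ι → ℝ}

/-- **First partials of the head pressure.** For smooth `U`, `P`:
`∂ₗΠ = ∑ᵢ (Uᵢ + a yᵢ) ∂ₗUᵢ + ∂ₗP + a Uₗ` (product rule; `∂ₗ yᵢ = δᵢₗ`). [folklore] -/
theorem pderiv_headPressure (hU : ContDiff ℝ ∞ U) (hP : ContDiff ℝ ∞ P) (a : ℝ) (l : ι) :
    pderiv l (headPressure a U P) = fun y =>
      ∑ i, (U y i + a * y i) * pderiv l (fun z => U z i) y + pderiv l P y + a * U y l := by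
  have hUi : ∀ i, Differentiable ℝ (fun z : 𝔼 => U z i) := fun i =>
    (contDiff_comp_euclidean hU i).differentiable (by simp)
  have hPd : Differentiable ℝ P := hP.differentiable (by simp)
  have h1 : Differentiable ℝ (fun y : 𝔼 => 2⁻¹ * ∑ i, (U y i) ^ 2) :=
    (Differentiable.fun_sum fun i _ => (hUi i).pow 2).const_mul _
  have h2 : Differentiable ℝ (fun y : 𝔼 => ∑ i, y i * U y i) :=
    Differentiable.fun_sum fun i _ => (differentiable_euclideanCoord i).mul (hUi i)
  have h3 : Differentiable ℝ (fun y : 𝔼 => a * ∑ i, y i * U y i) := h2.const_mul _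
  rw [headPressure_eq_sum,
    pderiv_add (f := fun y => 2⁻¹ * ∑ i, (U y i) ^ 2 + P y) (g := fun y => a * ∑ i, y i * U y i)
      (h1.add hPd) h3,
    pderiv_add (f := fun y => 2⁻¹ * ∑ i, (U y i) ^ 2) (g := P) h1 hPd,
    pderiv_const_mul (f := fun y => ∑ i, (U y i) ^ 2) (Differentiable.fun_sum fun i _ => (hUi i).pow 2),
    pderiv_const_mul (f := fun y => ∑ i, y i * U y i) h2,
    pderiv_sum (f := fun i y => (U y i) ^ 2) _ (fun i _ => (hUi i).pow 2),
    pderiv_sum (f := fun i y => y i * U y i) _ (fun i _ => (differentiable_euclideanCoord i).mul (hUi i))]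
  funext y
  have hsq : ∀ i, pderiv l (fun z : 𝔼 => U z i ^ 2) y = 2 * U y i * pderiv l (fun z => U z i) y := by
    intro i
    have := congrFun (pderiv_pow (hUi i) 1 l) y
    simp only [pow_one, Nat.cast_one] at this
    rw [this]
    ring
  have hprod : ∀ i, pderiv l (fun z : 𝔼 => z i * U z i) y =
      (if i = l then 1 else 0) * U y i + y i * pderiv l (fun z => U z i) y := by
    intro i
    rw [pderiv_mul (differentiable_euclideanCoord i) (hUi i), pderiv_euclideanCoord]
  simp only [hsq, hprod, Finset.sum_add_distrib, Finset.mul_sum, add_mul]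
  simp only [ite_mul, one_mul, zero_mul, Finset.sum_ite_eq', Finset.mem_univ, if_true]
  have e : ∑ i, 2⁻¹ * (2 * U y i * pderiv l (fun z => U z i) y) =
      ∑ i, U y i * pderiv l (fun z => U z i) y :=
    Finset.sum_congr rfl fun i _ => by ring
  have e' : ∑ i, a * (y i * pderiv l (fun z => U z i) y) =
      ∑ i, a * y i * pderiv l (fun z => U z i) y :=
    Finset.sum_congr rfl fun i _ => by ring
  rw [e, mul_add, Finset.mul_sum, e']
  ring


/-- **Pure second partials of the head pressure.** For smooth `U`, `P`:
`∂ₗ∂ₗΠ = ∑ᵢ (∂ₗUᵢ)² + ∑ᵢ (Uᵢ + a yᵢ) ∂ₗ∂ₗUᵢ + ∂ₗ∂ₗP + 2a ∂ₗUₗ`. [folklore] -/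
theorem pderiv_pderiv_headPressure (hU : ContDiff ℝ ∞ U) (hP : ContDiff ℝ ∞ P) (a : ℝ) (l : ι) :
    pderiv l (pderiv l (headPressure a U P)) = fun y =>
      ∑ i, pderiv l (fun z => U z i) y ^ 2 +
        ∑ i, (U y i + a * y i) * pderiv l (pderiv l (fun z => U z i)) y +
        pderiv l (pderiv l P) y + 2 * a * pderiv l (fun z => U z l) y := by
  have hUc : ∀ i, ContDiff ℝ ∞ (fun z : 𝔼 => U z i) := fun i => contDiff_comp_euclidean hU i
  have hUi : ∀ i, Differentiable ℝ (fun z : 𝔼 => U z i) := fun i =>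
    (hUc i).differentiable (by simp)
  have hdUi : ∀ i, Differentiable ℝ (pderiv l (fun z : 𝔼 => U z i)) := fun i =>
    (contDiff_pderiv (hUc i) l).differentiable (by simp)
  have hdP : Differentiable ℝ (pderiv l P) := (contDiff_pderiv hP l).differentiable (by simp)
  have hw : ∀ i, Differentiable ℝ (fun y : 𝔼 => U y i + a * y i) := fun i =>
    (hUi i).add ((differentiable_euclideanCoord i).const_mul a)
  have h1 : Differentiable ℝ (fun y : 𝔼 => ∑ i, (U y i + a * y i) * pderiv l (fun z => U z i) y) :=
    Differentiable.fun_sum fun i _ => (hw i).mul (hdUi i)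
  rw [pderiv_headPressure hU hP a l,
    pderiv_add (f := fun y => ∑ i, (U y i + a * y i) * pderiv l (fun z => U z i) y + pderiv l P y)
      (g := fun y => a * U y l) (h1.add hdP) ((hUi l).const_mul a),
    pderiv_add (f := fun y => ∑ i, (U y i + a * y i) * pderiv l (fun z => U z i) y)
      (g := pderiv l P) h1 hdP,
    pderiv_const_mul (f := fun y => U y l) (hUi l),
    pderiv_sum (f := fun i y => (U y i + a * y i) * pderiv l (fun z => U z i) y) _
      (fun i _ => (hw i).mul (hdUi i))]
  funext y
  have hA : ∀ i, pderiv l (fun y : 𝔼 => (U y i + a * y i) * pderiv l (fun z => U z i) y) y =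
      (pderiv l (fun z => U z i) y + a * (if i = l then 1 else 0)) * pderiv l (fun z => U z i) y +
        (U y i + a * y i) * pderiv l (pderiv l (fun z => U z i)) y := by
    intro i
    rw [pderiv_mul (hw i) (hdUi i),
      pderiv_add (f := fun y => U y i) (g := fun y => a * y i) (hUi i)
        ((differentiable_euclideanCoord i).const_mul a),
      pderiv_const_mul (f := fun y : 𝔼 => y i) (differentiable_euclideanCoord i), pderiv_euclideanCoord]
  beta_reduce
  rw [Finset.sum_congr rfl fun k _ => hA k]
  simp only [Finset.sum_add_distrib, add_mul]
  simp only [mul_ite, mul_one, mul_zero, ite_mul, zero_mul, Finset.sum_ite_eq', Finset.mem_univ,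
    if_true]
  have e : ∑ i, pderiv l (fun z => U z i) y * pderiv l (fun z => U z i) y =
      ∑ i, pderiv l (fun z => U z i) y ^ 2 := Finset.sum_congr rfl fun i _ => by ring
  rw [e]
  ring

/-- **Leray's profile system in coordinates** (Tsai 1998, (1.3); p. 48, last display): for every
`i`, `−ν ∑ⱼ ∂ⱼ∂ⱼUᵢ + aUᵢ + a ∑ⱼ yⱼ ∂ⱼUᵢ + ∑ⱼ Uⱼ ∂ⱼUᵢ + ∂ᵢP = 0`. [cite: Tsai1998, (1.3)] -/
theorem IsLerayProfile.profile_comp (h : IsLerayProfile ν a U P) (y : 𝔼) (i : ι) :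
    -(ν * ∑ j, pderiv j (pderiv j fun z => U z i) y) + a * U y i +
      a * ∑ j, y j * pderiv j (fun z => U z i) y + ∑ j, U y j * pderiv j (fun z => U z i) y +
      pderiv i P y = 0 := by
  have hm := congrArg (fun w : 𝔼 => w i) (h.profile_eq y)
  have hdiff : DifferentiableAt ℝ U y := (h.contDiff_velocity.differentiable (by simp)) y
  simp only [PiLp.add_apply, PiLp.neg_apply, PiLp.smul_apply, smul_eq_mul, PiLp.zero_apply] at hm
  rw [laplacian_apply_comp h.contDiff_velocity, euclidean_fderiv_apply_comp hdiff,
    fderiv_apply_eq_sum_mul_pderiv, convect_apply_comp hdiff, gradient_apply_comp] at hm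
  exact hm

/-- Incompressibility of a Leray profile in coordinates: `∑ᵢ ∂ᵢUᵢ = 0` (Tsai 1998, (1.3)₂). [cite: Tsai1998, (1.3)] -/
theorem IsLerayProfile.sum_pderiv_comp_eq_zero (h : IsLerayProfile ν a U P) (y : 𝔼) :
    ∑ i, pderiv i (fun z => U z i) y = 0 :=
  h.divFree.sum_pderiv_comp_eq_zero (h.contDiff_velocity.differentiable (by simp)) y

/-- The pressure gradient of a Leray profile, solved from the profile system:
`∂ᵢP = ν ∑ⱼ ∂ⱼ∂ⱼUᵢ − aUᵢ − ∑ⱼ (Uⱼ + a yⱼ) ∂ⱼUᵢ` (Tsai 1998, (1.3)). [cite: Tsai1998, (1.3)] -/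
theorem IsLerayProfile.pderiv_pressure_eq (h : IsLerayProfile ν a U P) (i : ι) :
    pderiv i P = fun y => ν * ∑ j, pderiv j (pderiv j fun z => U z i) y - a * U y i -
      ∑ j, (U y j + a * y j) * pderiv j (fun z => U z i) y := by
  funext y
  have h1 := h.profile_comp y i
  have e : ∑ j, (U y j + a * y j) * pderiv j (fun z => U z i) y =
      ∑ j, U y j * pderiv j (fun z => U z i) y + a * ∑ j, y j * pderiv j (fun z => U z i) y := by
    simp only [add_mul, Finset.sum_add_distrib, Finset.mul_sum, mul_assoc]
  rw [e]
  linarith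

/-- **The pressure of a smooth-velocity Leray profile is smooth** (Tsai 1998, p. 34: "Since `U`
is smooth, `P` is also smooth"): every `∂ᵢP` is smooth by `pderiv_pressure_eq`, hence so is
`DP = ∑ᵢ ∂ᵢP • eᵢ*`, and `P` is smooth by `contDiff_infty_iff_fderiv`. [cite: Tsai1998, p. 34] -/
theorem IsLerayProfile.contDiff_pressure_of_smooth (h : IsLerayProfile ν a U P)
    (hU : ContDiff ℝ ∞ U) : ContDiff ℝ ∞ P := by
  have hUc : ∀ i, ContDiff ℝ ∞ (fun z : 𝔼 => U z i) := fun i => contDiff_comp_euclidean hU i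
  have hPd : Differentiable ℝ P := h.contDiff_pressure.differentiable (by simp)
  have hpi : ∀ i, ContDiff ℝ ∞ (pderiv i P) := by
    intro i
    rw [h.pderiv_pressure_eq i]
    refine ((contDiff_const.mul (ContDiff.sum fun j _ =>
      contDiff_pderiv (contDiff_pderiv (hUc i) j) j)).sub (contDiff_const.mul (hUc i))).sub
      (ContDiff.sum fun j _ => ((hUc j).add (contDiff_const.mul (contDiff_euclideanCoord j))).mul
        (contDiff_pderiv (hUc i) j))
  have hf : fderiv ℝ P = fun y => ∑ i, pderiv i P y • (EuclideanSpace.proj i : 𝔼 →L[ℝ] ℝ) := by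
    funext y
    ext w
    rw [fderiv_apply_eq_sum_mul_pderiv, _root_.sum_apply]
    refine Finset.sum_congr rfl fun i _ => ?_
    rw [_root_.smul_apply, smul_eq_mul, mul_comm]
    rfl
  rw [contDiff_infty_iff_fderiv, hf]
  exact ⟨hPd, ContDiff.sum fun i _ => (hpi i).smul contDiff_const⟩

/-- First derivatives of the incompressibility constraint: `∑ₗ ∂ₗ∂ⱼUₗ = ∂ⱼ(div U) = 0` for a
smooth Leray profile. [folklore] -/
theorem IsLerayProfile.sum_pderiv_pderiv_comp_eq_zero (h : IsLerayProfile ν a U P)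
    (hU : ContDiff ℝ ∞ U) (j : ι) (y : 𝔼) :
    ∑ l, pderiv l (pderiv j fun z => U z l) y = 0 := by
  have hdiv : ∀ x : 𝔼, ∑ i, pderiv i (fun z => U z i) x = 0 := h.sum_pderiv_comp_eq_zero
  have := sum_pderiv_ipderiv_eq_zero hU hdiv (Fin.cons j (![] : Fin 0 → ι)) y
  simpa only [ipderiv_cons, ipderiv_zero] using this

/-- Second derivatives of the incompressibility constraint: `∑ₗ ∂ₗ∂ₖ∂ₖUₗ = ∂ₖ∂ₖ(div U) = 0` for a
smooth Leray profile. [folklore] -/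
theorem IsLerayProfile.sum_pderiv_pderiv_pderiv_comp_eq_zero (h : IsLerayProfile ν a U P)
    (hU : ContDiff ℝ ∞ U) (k : ι) (y : 𝔼) :
    ∑ l, pderiv l (pderiv k (pderiv k fun z => U z l)) y = 0 := by
  have hdiv : ∀ x : 𝔼, ∑ i, pderiv i (fun z => U z i) x = 0 := h.sum_pderiv_comp_eq_zero
  have := sum_pderiv_ipderiv_eq_zero hU hdiv (Fin.cons k (Fin.cons k (![] : Fin 0 → ι))) y
  simpa only [ipderiv_cons, ipderiv_zero] using this


/-- Pure second partials of the pressure of a smooth Leray profile, from `pderiv_pressure_eq`: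
`∂ₗ∂ₗP = ν ∑ₖ ∂ₗ∂ₖ∂ₖUₗ − a ∂ₗUₗ − ∑ⱼ (∂ₗUⱼ + a δⱼₗ) ∂ⱼUₗ − ∑ⱼ (Uⱼ + a yⱼ) ∂ₗ∂ⱼUₗ`. [folklore] -/
theorem IsLerayProfile.pderiv_pderiv_pressure (h : IsLerayProfile ν a U P) (hU : ContDiff ℝ ∞ U)
    (l : ι) (y : 𝔼) :
    pderiv l (pderiv l P) y =
      ν * ∑ k, pderiv l (pderiv k (pderiv k fun z => U z l)) y - a * pderiv l (fun z => U z l) y -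
        (∑ j, (pderiv l (fun z => U z j) y + a * if j = l then 1 else 0) *
            pderiv j (fun z => U z l) y +
          ∑ j, (U y j + a * y j) * pderiv l (pderiv j fun z => U z l) y) := by
  have hUc : ∀ i, ContDiff ℝ ∞ (fun z : 𝔼 => U z i) := fun i => contDiff_comp_euclidean hU i
  have hUi : ∀ i, Differentiable ℝ (fun z : 𝔼 => U z i) := fun i =>
    (hUc i).differentiable (by simp)
  have hd : ∀ j i, Differentiable ℝ (pderiv j (fun z : 𝔼 => U z i)) := fun j i =>
    (contDiff_pderiv (hUc i) j).differentiable (by simp)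
  have hdd : ∀ k i, Differentiable ℝ (pderiv k (pderiv k (fun z : 𝔼 => U z i))) := fun k i =>
    (contDiff_pderiv (contDiff_pderiv (hUc i) k) k).differentiable (by simp)
  have hw : ∀ i, Differentiable ℝ (fun y : 𝔼 => U y i + a * y i) := fun i =>
    (hUi i).add ((differentiable_euclideanCoord i).const_mul a)
  have h1 : Differentiable ℝ (fun y : 𝔼 => ∑ k, pderiv k (pderiv k fun z => U z l) y) :=
    Differentiable.fun_sum fun k _ => hdd k l
  have h2 : Differentiable ℝ (fun y : 𝔼 => ∑ j, (U y j + a * y j) * pderiv j (fun z => U z l) y) :=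
    Differentiable.fun_sum fun j _ => (hw j).mul (hd j l)
  have key := congrFun (show pderiv l (pderiv l P) = fun y =>
      pderiv l (fun y => ν * ∑ k, pderiv k (pderiv k fun z => U z l) y) y -
        pderiv l (fun y => a * U y l) y -
        pderiv l (fun y => ∑ j, (U y j + a * y j) * pderiv j (fun z => U z l) y) y from by
    rw [h.pderiv_pressure_eq l,
      pderiv_sub (f := fun y => ν * ∑ k, pderiv k (pderiv k fun z => U z l) y - a * U y l)
        (g := fun y => ∑ j, (U y j + a * y j) * pderiv j (fun z => U z l) y)
        ((h1.const_mul ν).sub ((hUi l).const_mul a)) h2,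
      pderiv_sub (f := fun y => ν * ∑ k, pderiv k (pderiv k fun z => U z l) y)
        (g := fun y => a * U y l) (h1.const_mul ν) ((hUi l).const_mul a)]) y
  rw [key]
  beta_reduce
  rw [congrFun (pderiv_const_mul (f := fun y => ∑ k, pderiv k (pderiv k fun z => U z l) y) h1 ν l) y,
    congrFun (pderiv_const_mul (f := fun y => U y l) (hUi l) a l) y,
    congrFun (pderiv_sum (f := fun k y => pderiv k (pderiv k fun z => U z l) y) Finset.univ
      (fun k _ => hdd k l) l) y,
    congrFun (pderiv_sum (f := fun j y => (U y j + a * y j) * pderiv j (fun z => U z l) y)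
      Finset.univ (fun j _ => (hw j).mul (hd j l)) l) y]
  beta_reduce
  have hA : ∀ j, pderiv l (fun y : 𝔼 => (U y j + a * y j) * pderiv j (fun z => U z l) y) y =
      (pderiv l (fun z => U z j) y + a * if j = l then 1 else 0) * pderiv j (fun z => U z l) y +
        (U y j + a * y j) * pderiv l (pderiv j fun z => U z l) y := by
    intro j
    rw [pderiv_mul (hw j) (hd j l),
      pderiv_add (f := fun y => U y j) (g := fun y => a * y j) (hUi j)
        ((differentiable_euclideanCoord j).const_mul a),
      pderiv_const_mul (f := fun y : 𝔼 => y j) (differentiable_euclideanCoord j), pderiv_euclideanCoord]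
  rw [Finset.sum_congr rfl fun j _ => hA j, Finset.sum_add_distrib]

/-- **Pressure Poisson equation, trace form** (Tsai 1998, (2.1): `−ΔP = ∑ ∂ᵢ∂ⱼ(UᵢUⱼ)`): for a
smooth Leray profile, `∑ₗ ∂ₗ∂ₗP = −∑ₗⱼ ∂ₗUⱼ ∂ⱼUₗ` (the drift terms `aU + a(y·∇)U` and `νΔU` are
divergence free, and `div((U·∇)U) = tr((∇U)²)` when `div U = 0`). [cite: Tsai1998, (2.1)] -/
theorem IsLerayProfile.sum_pderiv_pderiv_pressure (h : IsLerayProfile ν a U P)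
    (hU : ContDiff ℝ ∞ U) (y : 𝔼) :
    ∑ l, pderiv l (pderiv l P) y =
      -∑ l, ∑ j, pderiv l (fun z => U z j) y * pderiv j (fun z => U z l) y := by
  have hdiv : ∑ l, pderiv l (fun z => U z l) y = 0 := h.sum_pderiv_comp_eq_zero y
  have h3 : ∑ l, ν * ∑ k, pderiv l (pderiv k (pderiv k fun z => U z l)) y = 0 := by
    rw [← Finset.mul_sum, Finset.sum_comm]
    simp [h.sum_pderiv_pderiv_pderiv_comp_eq_zero hU]
  have h4 : ∑ l, ∑ j, (U y j + a * y j) * pderiv l (pderiv j fun z => U z l) y = 0 := by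
    rw [Finset.sum_comm]
    refine Finset.sum_eq_zero fun j _ => ?_
    rw [← Finset.mul_sum, h.sum_pderiv_pderiv_comp_eq_zero hU j y, mul_zero]
  have h5 : ∑ l, ∑ j, (pderiv l (fun z => U z j) y + a * if j = l then 1 else 0) *
      pderiv j (fun z => U z l) y =
      ∑ l, ∑ j, pderiv l (fun z => U z j) y * pderiv j (fun z => U z l) y +
        a * ∑ l, pderiv l (fun z => U z l) y := by
    simp only [add_mul, Finset.sum_add_distrib, mul_ite, mul_one, mul_zero, ite_mul, zero_mul,
      Finset.sum_ite_eq', Finset.mem_univ, if_true, Finset.mul_sum]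
  simp only [h.pderiv_pderiv_pressure hU, Finset.sum_sub_distrib, Finset.sum_add_distrib]
  rw [h3, h4, h5, ← Finset.mul_sum, hdiv]
  ring


end Coord

end Literature.Analysis.FluidPDE

end
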